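import Mathlib
import HarnessLib
import HarnessLib.Audit
import Summits.AtomisticToContinuum.Statement
import Literature.Analysis.FluidPDE.HardSphereFlowConstruction

/-! Scratch: c7's promoted texts (LHS of the landed `…_promoted_iff`), elaborated in the route-file context. -/

namespace Summit.AtomisticToContinuum.HydrodynamicLimit.Theses.CollisionIsometryCLT

open scoped BigOperators Topology Manifold Classical MeasureTheory ProbabilityTheory Matrix InnerProductSpace ComplexConjugate ContinuousMap
open Filter Set Function TopologicalSpace MeasureTheory

/-- child TracerNearSetLD (c7 text). -/
def TracerNearSetLD : Prop :=
  ∃ σ₀ : ℝ, 0 < σ₀ ∧ ∀ σ : ℝ, 0 < σ → σ < σ₀ → let G := Literature.Analysis.FluidPDE.Torus.geometry (Fin 3); let V := EuclideanSpace ℝ (Fin 3); let X := fun (N : ℕ) => Literature.Analysis.FluidPDE.Config (N + 1) (Fin 3) (UnitAddTorus (Fin 3)); let ε := fun (N : ℕ) => Literature.MathematicalPhysics.KineticTheory.hsDiameter σ N; let pre := fun (N : ℕ) (y : X N) (k : ℕ) => let z := Literature.Analysis.FluidPDE.Alexander.stateAfter G (ε N) y k; Literature.Analysis.FluidPDE.freeFlight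 G (Literature.Analysis.FluidPDE.Alexander.freeExitTime G (ε N) z).toReal z; let pairs := fun (N : ℕ) (y : X N) (k : ℕ) => Literature.Analysis.FluidPDE.Alexander.incomingPairs G (ε N) (pre N y k); let D := fun (N : ℕ) (y : X N) (k : ℕ) => Classical.propDecidable (pairs N y k).Nonempty; let stepF := fun (N : ℕ) (y : X N) (W' : Fin (N + 1) → V) (k : ℕ) => @dite (Fin (N + 1) → V) (pairs N y k).Nonempty (D N y k) (fun h => fun i => (Literature.Analysis.FluidPDE.collidePair G h.some.1 h.some.2 (fun j => ((pre N y k j).1, W' j)) i).2) (fun _ => W'); let colls := fun (N : ℕ) (y : X N) (Δ : ℝ) => Literature.Analysis.FluidPDE.Alexander.collisionCount G (ε N) y Δ; let MN := fun (N : ℕ) (y : X N) (n : ℕ) (W : Fin (N + 1) → V) => (List.range n).foldl (stepF N y) W; let bc := fun (N : ℕ) (y : X N) (n : ℕ) (i k : Fin (N + 1)) (a : Fin 3) => MN N y n (Pi.single k (EuclideanSpace.single a (1 : ℝ))) i; let bm := fun (N : ℕ) (y : X N) (n : ℕ) (i k : Fin (N + 1)) => ∑ a : Fin 3, ‖bc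 N y n i k a‖ ^ 2; let nrm := fun (N : ℕ) (y : X N) (k : ℕ) => @dite V (pairs N y k).Nonempty (D N y k) (fun h => G.sepVec (pre N y k h.some.1).1 (pre N y k h.some.2).1) (fun _ => 0); let un := fun (N : ℕ) (y : X N) (k : ℕ) => ‖nrm N y k‖⁻¹ • nrm N y k; let sls := fun (N : ℕ) (y : X N) (Δ : ℝ) (S r : ℕ) => colls N y ((r : ℝ) * Δ / (S : ℝ)); let tch := fun (N : ℕ) (y : X N) (k : ℕ) (i : Fin (N + 1)) => ∃ h : (pairs N y k).Nonempty, h.some.1 = i ∨ h.some.2 = i; let hci := fun (N : ℕ) (y : X N) (Δ : ℝ) (S r : ℕ) (i : Fin (N + 1)) => ∃ k, sls N y Δ S r ≤ k ∧ k < sls N y Δ S (r + 1) ∧ tch N y k i; let nd := fun (α : ℝ) (u : Fin 3 → V) => {ω : V | ∃ a : Fin 3, (∀ b, ‖u b‖ ≤ ‖u a‖) ∧ (inner ℝ ω (‖u a‖⁻¹ • u a) ^ 2 < α ^ 2 ∨ 1 - α ^ 2 < inner ℝ ω (‖u a‖⁻¹ • u a) ^ 2)}; let nsc := fun (N : ℕ)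 (y : X N) (Δ : ℝ) (S r : ℕ) (α : ℝ) (i : Fin (N + 1)) => @dite ℝ (hci N y Δ S r i) (Classical.propDecidable _) (fun h => let n : ℕ := @Nat.find (fun k => sls N y Δ S r ≤ k ∧ k < sls N y Δ S (r + 1) ∧ tch N y k i) (fun _ => @instDecidableAnd _ _ inferInstance (@instDecidableAnd _ _ inferInstance (Classical.propDecidable _))) h; ∑ k : Fin (N + 1), bm N y n i k / 3 * @ite ℝ (un N y n ∈ nd α (bc N y n i k)) (Classical.propDecidable _) (1 : ℝ) 0) (fun _ => 0); let eqL := fun (θ : ℝ) (N : ℕ) (Φ : Literature.Analysis.FluidPDE.HardSphereFlow G (ε N) (N + 1)) => Literature.MathematicalPhysics.KineticTheory.localGibbsLaw σ (fun _ => 1) (fun _ => 0) (fun _ => θ) N Φ; ∀ θ : ℝ, 0 < θ → ∃ K : ℝ, 0 < K ∧ ∀ δ α : ℝ, 0 < δ → 0 < α → α < 1 → ∀ Δ : ℕ → ℝ, (∀ N, 0 < Δ N) → Tendsto Δ atTop (𝓝 0) → Tendsto (fun N : ℕ => Δ N * ((N + 1 : ℕ) : ℝ) ^ ((1 : ℝ)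 / 3)) atTop atTop → ∀ S r : ℕ, 1 ≤ S → r < S → ∀ᶠ N : ℕ in atTop, ∀ (Φ : Literature.Analysis.FluidPDE.HardSphereFlow G (ε N) (N + 1)) (A : Finset (Fin (N + 1))), δ * ((N : ℝ) + 1) ≤ (A.card : ℝ) → eqL θ N Φ {y : X N | ∀ i ∈ A, δ ≤ nsc N y (Δ N) S r α i} ≤ ENNReal.ofReal ((K * α / δ) ^ ((A.card : ℝ) / 2))

/-- child TracerRemergeBounded (c7 text). -/
def TracerRemergeBounded : Prop :=
  ∀ (a₀ θ₀ : UnitAddTorus (Fin 3) → ℝ) (u₀ : UnitAddTorus (Fin 3) → EuclideanSpace ℝ (Fin 3)), Continuous a₀ → Continuous θ₀ → Continuous u₀ → (∀ x, 0 < a₀ x) → (∀ x, 0 < θ₀ x) → ∃ σ₀ : ℝ, 0 < σ₀ ∧ ∀ σ : ℝ, 0 < σ → σ < σ₀ → let G := Literature.Analysis.FluidPDE.Torus.geometry (Fin 3); let V := EuclideanSpace ℝ (Fin 3); let X := fun (N : ℕ) => Literature.Analysis.FluidPDE.Config (N + 1) (Fin 3) (UnitAddTorus (Fin 3)); let ε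 := fun (N : ℕ) => Literature.MathematicalPhysics.KineticTheory.hsDiameter σ N; let pre := fun (N : ℕ) (y : X N) (k : ℕ) => let z := Literature.Analysis.FluidPDE.Alexander.stateAfter G (ε N) y k; Literature.Analysis.FluidPDE.freeFlight G (Literature.Analysis.FluidPDE.Alexander.freeExitTime G (ε N) z).toReal z; let pairs := fun (N : ℕ) (y : X N) (k : ℕ) => Literature.Analysis.FluidPDE.Alexander.incomingPairs G (ε N) (pre N y k); let D := fun (N : ℕ) (y : X N) (k : ℕ) => Classical.propDecidable (pairs N y k).Nonempty; let stepF := fun (N : ℕ) (y : X N) (W' : Fin (N + 1) → V) (k : ℕ) => @dite (Fin (N + 1) → V) (pairs N y k).Nonempty (D N y k) (fun h => fun i => (Literature.Analysis.FluidPDE.collidePair G h.some.1 h.some.2 (fun j => ((pre N y k j).1, W' j)) i).2) (fun _ => W'); let colls := fun (N : ℕ) (y : X N) (Δ : ℝ) => Literature.Analysis.FluidPDE.Alexander.collisionCount G (ε N) y Δ; let MN := fun (N : ℕ) (y : X N) (n : ℕ) (W : Fin (N + 1) → V) => (List.range n).foldl (stepF N y) W; let bc := fun (N : ℕ) (y :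 X N) (n : ℕ) (i k : Fin (N + 1)) (a : Fin 3) => MN N y n (Pi.single k (EuclideanSpace.single a (1 : ℝ))) i; let bm := fun (N : ℕ) (y : X N) (n : ℕ) (i k : Fin (N + 1)) => ∑ a : Fin 3, ‖bc N y n i k a‖ ^ 2; let nrm := fun (N : ℕ) (y : X N) (k : ℕ) => @dite V (pairs N y k).Nonempty (D N y k) (fun h => G.sepVec (pre N y k h.some.1).1 (pre N y k h.some.2).1) (fun _ => 0); let un := fun (N : ℕ) (y : X N) (k : ℕ) => ‖nrm N y k‖⁻¹ • nrm N y k; let bs := fun (N : ℕ) (y : X N) (n : ℕ) (i k : Fin (N + 1)) (ω : V) => ∑ a : Fin 3, inner ℝ ω (bc N y n i k a) ^ 2; let sf := fun (N : ℕ) (y : X N) (n : ℕ) (i k : Fin (N + 1)) (ω : V) => bs N y n i k ω / bm N y n i k; let mAt := fun (N : ℕ) (y : X N) (src : Fin (N + 1)) (k : ℕ) => @dite ℝ (pairs N y k).Nonempty (D N y k) (fun h => 2 * (bm N y k h.some.1 src / 3) * (bm N y k h.some.2 src / 3) * (sf N y k h.some.1 src (un N y k) * (1 - sf N y k h.some.2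 src (un N y k)) + sf N y k h.some.2 src (un N y k) * (1 - sf N y k h.some.1 src (un N y k)))) (fun _ => 0); let tRF := fun (N : ℕ) (y : X N) (Δ : ℝ) => ((N + 1 : ℕ) : ℝ)⁻¹ * ∑ src : Fin (N + 1), ∑ c ∈ Finset.range (colls N y Δ), mAt N y src c; ∀ Φ : (N : ℕ) → Literature.Analysis.FluidPDE.HardSphereFlow G (ε N) (N + 1), ∀ Δ : ℕ → ℝ, (∀ N, 0 < Δ N) → Tendsto Δ atTop (𝓝 0) → Tendsto (fun N : ℕ => Δ N * ((N + 1 : ℕ) : ℝ) ^ ((1 : ℝ) / 3)) atTop atTop → ∀ t : ℝ, 0 < t → ∃ M : ℝ, 0 ≤ M ∧ ∀ᶠ N : ℕ in atTop, ∫⁻ z, ENNReal.ofReal (tRF N ((Φ N).flow (t - Δ N) z) (Δ N)) ∂(Literature.MathematicalPhysics.KineticTheory.localGibbsLaw σ a₀ u₀ θ₀ N (Φ N)) ≤ ENNReal.ofReal M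

/-- child TracerDelayedRemergeRare (c7 text). -/
def TracerDelayedRemergeRare : Prop :=
  ∀ (a₀ θ₀ : UnitAddTorus (Fin 3) → ℝ) (u₀ : UnitAddTorus (Fin 3) → EuclideanSpace ℝ (Fin 3)), Continuous a₀ → Continuous θ₀ → Continuous u₀ → (∀ x, 0 < a₀ x) → (∀ x, 0 < θ₀ x) → ∃ σ₀ : ℝ, 0 < σ₀ ∧ ∀ σ : ℝ, 0 < σ → σ < σ₀ → let G := Literature.Analysis.FluidPDE.Torus.geometry (Fin 3); let V := EuclideanSpace ℝ (Fin 3); let X := fun (N : ℕ) => Literature.Analysis.FluidPDE.Config (N + 1) (Fin 3) (UnitAddTorus (Fin 3)); let ε := fun (N : ℕ) => Literature.MathematicalPhysics.KineticTheory.hsDiameter σ N; let pre := fun (N : ℕ) (y : X N) (k : ℕ) => let z := Literature.Analysis.FluidPDE.Alexander.stateAfter G (ε N) y k; Literature.Analysis.FluidPDE.freeFlight G (Literature.Analysis.FluidPDE.Alexander.freeExitTime G (ε N) z).toReal z; let pairs := fun (N : ℕ) (y : X N) (k : ℕ) => Literature.Analysis.FluidPDE.Alexander.incomingPairs G (ε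 N) (pre N y k); let D := fun (N : ℕ) (y : X N) (k : ℕ) => Classical.propDecidable (pairs N y k).Nonempty; let stepF := fun (N : ℕ) (y : X N) (W' : Fin (N + 1) → V) (k : ℕ) => @dite (Fin (N + 1) → V) (pairs N y k).Nonempty (D N y k) (fun h => fun i => (Literature.Analysis.FluidPDE.collidePair G h.some.1 h.some.2 (fun j => ((pre N y k j).1, W' j)) i).2) (fun _ => W'); let colls := fun (N : ℕ) (y : X N) (Δ : ℝ) => Literature.Analysis.FluidPDE.Alexander.collisionCount G (ε N) y Δ; let MN := fun (N : ℕ) (y : X N) (n : ℕ) (W : Fin (N + 1) → V) => (List.range n).foldl (stepF N y) W; let bc := fun (N : ℕ) (y : X N) (n : ℕ) (i k : Fin (N + 1)) (a : Fin 3) => MN N y n (Pi.single k (EuclideanSpace.single a (1 : ℝ))) i; let bm := fun (N : ℕ) (y : X N) (n : ℕ) (i k : Fin (N + 1)) => ∑ a : Fin 3, ‖bc N y n i k a‖ ^ 2; let nrm := fun (N : ℕ) (y : X N) (k : ℕ) => @dite V (pairs N y k).Nonempty (D N y k) (fun h => G.sepVec (pre N y k h.some.1).1 (pre N y k h.some.2).1)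 (fun _ => 0); let un := fun (N : ℕ) (y : X N) (k : ℕ) => ‖nrm N y k‖⁻¹ • nrm N y k; let bs := fun (N : ℕ) (y : X N) (n : ℕ) (i k : Fin (N + 1)) (ω : V) => ∑ a : Fin 3, inner ℝ ω (bc N y n i k a) ^ 2; let sf := fun (N : ℕ) (y : X N) (n : ℕ) (i k : Fin (N + 1)) (ω : V) => bs N y n i k ω / bm N y n i k; let sls := fun (N : ℕ) (y : X N) (Δ : ℝ) (S r : ℕ) => colls N y ((r : ℝ) * Δ / (S : ℝ)); let hop := fun (N : ℕ) (y : X N) (src : Fin (N + 1)) (n : ℕ) (i' i : Fin (N + 1)) => @dite ℝ (pairs N y n).Nonempty (D N y n) (fun h => let p := h.some.1; let q := h.some.2; let f := fun (j : Fin (N + 1)) => sf N y n j src (un N y n); if i' = p then (if i = p then 1 - f p else if i = q then f p else 0) else if i' = q then (if i = q then 1 - f q else if i = p then f q else 0) else if i = i' then 1 else 0) (fun _ => if i = i' then 1 else 0); let apart := fun (N : ℕ) (y : X N) (src : Fin (N + 1)) (Δ : ℝ) (S r t : ℕ) => @Nat.rec (fun _ => Fin (N + 1) → Fin (N + 1)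 → ℝ) (fun i j => if i = j then 0 else bm N y (sls N y Δ S r) i src / 3 * (bm N y (sls N y Δ S r) j src / 3)) (fun t ih => fun i j => if i = j then 0 else ∑ i', ∑ j', ih i' j' * (hop N y src (sls N y Δ S r + t) i' i * hop N y src (sls N y Δ S r + t) j' j)) t; let dAt := fun (N : ℕ) (y : X N) (src : Fin (N + 1)) (Δ : ℝ) (S r t : ℕ) => let len := sls N y Δ S r - sls N y Δ S (r - 1); let n := sls N y Δ S (r - 1) + (len + t); ∑ i, ∑ i', ∑ j', apart N y src Δ S (r - 1) (len + t) i' j' * (hop N y src n i' i * hop N y src n j' i); let dFr := fun (N : ℕ) (y : X N) (Δ : ℝ) (S : ℕ) => ((N + 1 : ℕ) : ℝ)⁻¹ * ∑ src, ∑ r ∈ Finset.Ico 1 S, ∑ t ∈ Finset.range (sls N y Δ S (r + 1) - sls N y Δ S r), dAt N y src Δ S r t; ∀ Φ : (N : ℕ) → Literature.Analysis.FluidPDE.HardSphereFlow G (ε N) (N + 1), ∀ Δ : ℕ → ℝ, (∀ N, 0 < Δ N) → Tendsto Δ atTop (𝓝 0) → Tendsto (fun N : ℕ => Δ N * ((N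 + 1 : ℕ) : ℝ) ^ ((1 : ℝ) / 3)) atTop atTop → ∀ t : ℝ, 0 < t → ∀ S : ℕ, 2 ≤ S → ∀ e : ℝ, 0 < e → ∀ᶠ N : ℕ in atTop, ∫⁻ z, ENNReal.ofReal (dFr N ((Φ N).flow (t - Δ N) z) (Δ N) S) ∂(Literature.MathematicalPhysics.KineticTheory.localGibbsLaw σ a₀ u₀ θ₀ N (Φ N)) ≤ ENNReal.ofReal e

end Summit.AtomisticToContinuum.HydrodynamicLimit.Theses.CollisionIsometryCLT
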